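import Literature.Probability.RandomPlanarGeometry.LoewnerThrChain
import HarnessLib

/-!
# The conformal image of a chordal Loewner trace is the trace of the through-swallow image chain

Topic `Probability/RandomPlanarGeometry`; theorems only (crux `stmt-CriticalPhenomena-0698`, stub
`stub_isLocal`, (D) of the through-swallow programme of the locality of SLE₆: G. F. Lawler (2005),
§6.3 Thm. 6.13 — `γ*(t) = Φ ∘ γ(t)` is, after the capacity time change, the curve generating the
Loewner chain of `U*`, THROUGH the finitely many instants at which the hull swallows whole pieces of
`A`; Lawler–Schramm–Werner (2003), §5). The analogue of `LoewnerImageTip` with "alive at `β`" replaced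
by "the remaining hull `A ∖ K̂_t` is closed for `t ≤ β` and takes finitely many values on `[0, β]`, and
the curve avoids `A` on `[0, β]`":

* `invFunOn_map_thrImageDriverC` — **the inverse image Loewner map through the original one**: for
  `t < β` and `w ∈ ℍ`, `(ĝ_{σ t})⁻¹(w) = E_A(g_t⁻¹(Φ_{B_t}⁻¹(w − U*_t) + W_t))` with
  `B_t = thrSlidHull W A t = g_t(A ∖ K̂_t) − W_t` (`map_thrImageDriverC_eq` at a horizon between `t`
  and the swallowing time of the point, nested horizons `thrImageDriverC_eq_of_le`, locality of the
  chain in the driver `Loewner.domain_eq_of_eqOn`);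
* `tendsto_thr_preimagePoint` — `Φ_{B_t}⁻¹(w − U*_t) + W_t → W_t` within `ℍ` as `w → U*_t`;
* **`thr_apply_clockC_eq_of_finite`** — if the chain of `W` is generated by `γ` and the
  chain of a continuous `U'` equal to `U* ∘ τ` up to `σ β₂` (`β₂ < β`) is generated by `γ̂`, then
  `γ̂ (σ t) = E_A (γ t)` for every `t ≤ β₂` (both tips are limits of the inverse maps at the driving
  values within `ℍ`, `IsGeneratedByCurve.tendsto_invFunOn_map`).
-/

noncomputable section

open Set Filter Topology Function Complex Metric MeasureTheory
open UpperHalfPlane (upperHalfPlaneSet isOpen_upperHalfPlaneSet)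
open scoped NNReal

namespace Literature.Probability.RandomPlanarGeometry

namespace Loewner

variable {W : ℝ≥0 → ℝ} {A : Set ℂ}

/-! ### The inverse image Loewner map through the original one -/

/-- The point of the original chain over an image point `w ∈ ℍ` at time `t`:
`x(w) = Φ_{B_t}⁻¹(w − U*_t) + W_t` lies over `ℍ ∖ B_t` (`B_t` the through-swallow slid hull).
[folklore] -/
theorem thr_preimagePoint_mem (hW : Continuous W) (hA : IsStarHull A) {t : ℝ≥0}
    (hclt : IsClosed (remHull W A t)) {w : ℂ} (hw : w ∈ upperHalfPlaneSet) :
    ((starRMap (thrSlidHull W A t) (isStarHull_thrSlidHull hW hA hclt)).symm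
        (w - thrImageDriver W A t)) ∈ upperHalfPlaneSet \ thrSlidHull W A t := by
  refine (starRMap _ _).symm.mapsTo ?_
  show 0 < (w - (thrImageDriver W A t : ℂ)).im
  rw [sub_im, ofReal_im, sub_zero]; exact hw

section Tip

variable (hW : Continuous W) (hW0 : W 0 = 0) (hA : IsStarHull A) {β : ℝ≥0}
  (hcl : ∀ t ≤ β, IsClosed (remHull W A t)) (hfin : (remHull W A '' Icc 0 β).Finite)
include hW hA hcl hfin

include hW0 in
/-- **The inverse through-swallow image Loewner map through the original one**: for `t < β` and
`w ∈ ℍ`, `(ĝ_{σ t})⁻¹(w) = E_A(g_t⁻¹(Φ_{B_t}⁻¹(w − U*_t) + W_t))`, the inverses read as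
`Function.invFunOn` on the Loewner domains (the point over `w` is alive only shortly after `t`: its
image map is read through a horizon between `t` and its swallowing time, `map_thrImageDriverC_eq`,
and transferred by the locality of the chain in the driver). [cite: Lawler2005, §6.3 Thm. 6.13 (Φ_t = g*_t ∘ Φ ∘ g_t⁻¹); LawlerSchrammWerner2003Restriction, §5] -/
theorem invFunOn_map_thrImageDriverC {t : ℝ≥0} (ht : t < β) {w : ℂ} (hw : w ∈ upperHalfPlaneSet) :
    invFunOn (map (thrImageDriverC W A β) (thrClockC W A t)) (domain (thrImageDriverC W A β) (thrClockC W A t)) w =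
      starMap A (invFunOn (map W t) (domain W t)
        ((starRMap (thrSlidHull W A t) (isStarHull_thrSlidHull hW hA (hcl t ht.le))).symm
          (w - thrImageDriver W A t) + W t)) := by
  have hint := integrableOn_thrClockRate hW hA hcl hfin
  set B := thrSlidHull W A t with hBdef
  have hB : IsStarHull B := isStarHull_thrSlidHull hW hA (hcl t ht.le)
  set ΦB := starRMap B hB with hΦB
  set q : ℝ≥0 := thrClockC W A t with hqdef
  set c : ℝ := thrImageDriver W A t with hcdef
  -- the preimage point and the original point
  set y := ΦB.symm (w - c) with hydef
  have hy : y ∈ upperHalfPlaneSet \ B := thr_preimagePoint_mem hW hA (hcl t ht.le) hw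
  set x := y + W t with hxdef
  have hx : x ∈ upperHalfPlaneSet := by
    show 0 < (y + (W t : ℂ)).im
    rw [add_im, ofReal_im, add_zero]; exact hy.1
  set z := invFunOn (map W t) (domain W t) x with hzdef
  have hex : ∃ z' ∈ domain W t, map W t z' = x := (surjOn_map hW t) hx
  have hzdom : z ∈ domain W t := invFunOn_mem hex
  have hzeq : map W t z = x := invFunOn_eq hex
  obtain ⟨hzH, hzt⟩ := (mem_domain_iff W t z).1 hzdom
  have hyz : map W t z - W t = y := by rw [hzeq, hxdef, add_sub_cancel_right]
  have hzA : z ∉ A := fun hzA ↦ hy.2 ⟨z, (mem_remHull_iff hA hzA).2 hzt, hyz⟩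
  have hz0 : z ≠ 0 := fun h ↦ by
    have h' : 0 < z.im := hzH
    rw [h, Complex.zero_im] at h'
    exact lt_irrefl _ h'
  -- a horizon between `t` and the swallowing time of `z`, below `β`
  obtain ⟨β', htβ', hβ'β, hzβ'⟩ := exists_horizon (W := W) hzt ht
  have hcl' : ∀ s ≤ β', IsClosed (remHull W A s) := fun s hs ↦ hcl s (hs.trans hβ'β)
  have hfin' : (remHull W A '' Icc 0 β').Finite := hfin.subset (image_mono (Icc_subset_Icc_right hβ'β))
  have hint' := integrableOn_thrClockRate hW hA hcl' hfin'
  -- clock facts at the horizon `β'`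
  have htI : (t : ℝ) ∈ Icc (0 : ℝ) β' := ⟨t.coe_nonneg, NNReal.coe_le_coe.2 htβ'.le⟩
  have hqσ : (q : ℝ) = thrClock W A t := coe_thrClockC hint ht.le
  have hq' : (q : ℝ) < thrClock W A β' := by
    rw [hqσ]
    exact strictMonoOn_thrClock hint' htI ⟨β'.coe_nonneg, le_rfl⟩ (NNReal.coe_lt_coe.2 htβ')
  have hτ' : (thrClockInv W A β' q).toNNReal = t := by
    rw [hqσ, thrClockInv_thrClock hint' htI, Real.toNNReal_coe]
  -- the image point `E_A z` is in the image domain and is sent to `w`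
  have hEz : thrImageFlow W A 0 z = starMap A z := thrImageFlow_zero hW hW0 hA hz0
  have hEzH : 0 < (starMap A z).im := starMap_mem_of_mem_diff hA ⟨hzH, hzA⟩
  have hmem' : starMap A z ∈ domain (thrImageDriverC W A β') q := by
    have := thrImageFlow_zero_mem_domain hW hW0 hA hcl' hfin' hzH hzA hzβ' hq' (by rw [hEz]; exact hEzH)
    rwa [hEz] at this
  have hmap' : map (thrImageDriverC W A β') q (starMap A z) = w := by
    have h1 := map_thrImageDriverC_eq hW hW0 hA hcl' hfin' hzH hzA hzβ' hq'
    rw [hEz] at h1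
    rw [h1, thrImageFlowC_apply, hτ', thrImageFlow_eq_starMap_add]
    have hwc : w - (c : ℂ) ∈ upperHalfPlaneSet := by
      show 0 < (w - (c : ℂ)).im
      rw [sub_im, ofReal_im, sub_zero]; exact hw
    rw [hyz, starMap_of_mem_diff hB hy, hydef, ConformalEquiv.apply_symm_apply _ hwc, hcdef, sub_add_cancel]
  -- transfer to the horizon `β` (locality of the chain in the driver)
  have hUc := continuous_thrImageDriverC hW hW0 hA hcl hfin
  have hUc' := continuous_thrImageDriverC hW hW0 hA hcl' hfin'
  have heqd : ∀ s, s ≤ q → thrImageDriverC W A β' s = thrImageDriverC W A β s := fun s hs ↦ by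
    have hsI : (s : ℝ) ∈ Icc (0 : ℝ) (thrClock W A β') :=
      ⟨s.coe_nonneg, (NNReal.coe_le_coe.2 hs).trans hq'.le⟩
    have := thrImageDriverC_eq_of_le hW hA hcl hfin hβ'β hsI
    rwa [Real.toNNReal_coe] at this
  have hdom : domain (thrImageDriverC W A β) q = domain (thrImageDriverC W A β') q :=
    Loewner.domain_eq_of_eqOn hUc' hUc heqd
  have hmem : starMap A z ∈ domain (thrImageDriverC W A β) q := by rw [hdom]; exact hmem'
  have hmap : map (thrImageDriverC W A β) q (starMap A z) = w := by
    rw [Loewner.map_eq_of_eqOn hUc' hUc heqd ((mem_domain_iff _ _ _).1 hmem').2 le_rfl]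
    exact hmap'
  -- conclude by injectivity of the image map on its domain
  have hex'' : ∃ z' ∈ domain (thrImageDriverC W A β) q, map (thrImageDriverC W A β) q z' = w :=
    ⟨_, hmem, hmap⟩
  exact (injOn_map hUc q) (invFunOn_mem hex'') hmem ((invFunOn_eq hex'').trans hmap.symm)

omit hfin in
/-- **`x(w) → W_t` within `ℍ` as `w → U*_t` within `ℍ`** (`Φ_B⁻¹ → 0` at `0`,
`tendsto_starRMap_symm_nhdsWithin_zero`). [folklore] -/
theorem tendsto_thr_preimagePoint {t : ℝ≥0} (ht : t ≤ β) :
    Tendsto (fun w : ℂ ↦ (starRMap (thrSlidHull W A t)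
        (isStarHull_thrSlidHull hW hA (hcl t ht))).symm (w - thrImageDriver W A t) + W t)
      (𝓝[upperHalfPlaneSet] (thrImageDriver W A t : ℂ)) (𝓝[upperHalfPlaneSet] (W t : ℂ)) := by
  set B := thrSlidHull W A t with hBdef
  have hB : IsStarHull B := isStarHull_thrSlidHull hW hA (hcl t ht)
  set c : ℝ := thrImageDriver W A t with hcdef
  -- `w - c → 0` within `ℍ`
  have h1 : Tendsto (fun w : ℂ ↦ w - (c : ℂ)) (𝓝[upperHalfPlaneSet] (c : ℂ))
      (𝓝[upperHalfPlaneSet] 0) := by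
    refine tendsto_nhdsWithin_iff.2 ⟨?_, eventually_nhdsWithin_of_forall fun w hw ↦ ?_⟩
    · have : Tendsto (fun w : ℂ ↦ w - (c : ℂ)) (𝓝 (c : ℂ)) (𝓝 ((c : ℂ) - c)) :=
        (continuous_sub_right (c : ℂ)).tendsto (c : ℂ)
      rw [sub_self] at this
      exact this.mono_left nhdsWithin_le_nhds
    · show 0 < (w - (c : ℂ)).im
      rw [sub_im, ofReal_im, sub_zero]; exact hw
  -- `Φ_B⁻¹ → 0` within `ℍ`, with values in `ℍ`
  have h2 : Tendsto (starRMap B hB).symm (𝓝[upperHalfPlaneSet] 0) (𝓝[upperHalfPlaneSet] 0) :=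
    tendsto_nhdsWithin_iff.2 ⟨tendsto_starRMap_symm_nhdsWithin_zero hB,
      eventually_nhdsWithin_of_forall fun w hw ↦ ((starRMap B hB).symm.mapsTo hw).1⟩
  -- add `W_t`
  have h3 : Tendsto (fun y : ℂ ↦ y + (W t : ℂ)) (𝓝[upperHalfPlaneSet] 0)
      (𝓝[upperHalfPlaneSet] (W t : ℂ)) := by
    refine tendsto_nhdsWithin_iff.2 ⟨?_, eventually_nhdsWithin_of_forall fun y hy ↦ ?_⟩
    · have : Tendsto (fun y : ℂ ↦ y + (W t : ℂ)) (𝓝 0) (𝓝 ((0 : ℂ) + W t)) :=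
        (continuous_add_const (W t : ℂ)).tendsto (0 : ℂ)
      rw [zero_add] at this
      exact this.mono_left nhdsWithin_le_nhds
    · show 0 < (y + (W t : ℂ)).im
      rw [add_im, ofReal_im, add_zero]; exact hy
  exact h3.comp (h2.comp h1)

end Tip

/-! ### The image of the trace is the trace of the through-swallow image chain -/

/-- **(D) The image of the trace is the trace of the through-swallow image chain.** Let `W` be
continuous from `0`, `A` a nonempty `*`-hull, `β₂ < β` horizons such that the remaining hull
`A ∖ K̂_t` is closed for `t ≤ β` (clusterwise swallowing) and takes finitely many values on `[0, β]`,
the chain of `W` generated by `γ` with `γ` avoiding `A` on `[0, β]`, and the chain of a continuous `U'`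
equal to the through-swallow image driver `U* ∘ τ = thrImageDriverC W A β` up to `σ β₂` generated by
`γ̂`. Then `γ̂ (σ t) = E_A (γ t)` for every `t ≤ β₂`: both tips are limits of the inverse maps at the
driving values within `ℍ` (`IsGeneratedByCurve.tendsto_invFunOn_map`), the inverse maps are
intertwined by `E_A` and `x(·)` (`invFunOn_map_thrImageDriverC`), and `x(w) → W_t` within `ℍ`
(`tendsto_thr_preimagePoint`). [cite: Lawler2005, §6.3 Thm. 6.13 (γ* = Φ ∘ γ after the time change); LawlerSchrammWerner2003Restriction, §5] -/
theorem thr_apply_clockC_eq_of_finite (hW : Continuous W) (hW0 : W 0 = 0)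
    (hA : IsStarHull A) (_hne : A.Nonempty) {β β₂ : ℝ≥0} (hβ₂ : β₂ < β)
    (hcl : ∀ t ≤ β, IsClosed (remHull W A t)) (hfin : (remHull W A '' Icc 0 β).Finite)
    {γ : ℝ≥0 → ℂ} (hγ : IsGeneratedByCurve W γ) (hγA : ∀ t ≤ β, γ t ∉ A)
    {U' : ℝ≥0 → ℝ} (hU' : Continuous U')
    (hagree : ∀ s, s ≤ thrClockC W A β₂ → U' s = thrImageDriverC W A β s)
    {γ' : ℝ≥0 → ℂ} (hγ' : IsGeneratedByCurve U' γ') (t : ℝ≥0) (ht : t ≤ β₂) :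
    γ' (thrClockC W A t) = starMap A (γ t) := by
  have hint := integrableOn_thrClockRate hW hA hcl hfin
  have hUc := continuous_thrImageDriverC hW hW0 hA hcl hfin
  have htβ : t < β := lt_of_le_of_lt ht hβ₂
  set q := thrClockC W A t with hq
  have heq : ∀ s, s ≤ q → thrImageDriverC W A β s = U' s := fun s hs ↦
    (hagree s (hs.trans (thrClockC_mono hint ht hβ₂.le))).symm
  -- the driving value of `U'` at `q` is `U*_t`
  have hUq : U' q = thrImageDriver W A t := by
    rw [← heq q le_rfl, hq, thrImageDriverC_thrClockC hint htβ.le]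
  -- tip of the `U'`-chain at `q`
  have htip' := hγ'.tendsto_invFunOn_map hU' q
  rw [hUq] at htip'
  -- the inverse `U'`-map is the inverse image map
  have hev : ∀ w ∈ upperHalfPlaneSet, invFunOn (map U' q) (domain U' q) w =
      starMap A (invFunOn (map W t) (domain W t)
        ((starRMap (thrSlidHull W A t) (isStarHull_thrSlidHull hW hA (hcl t htβ.le))).symm
          (w - thrImageDriver W A t) + W t)) := by
    intro w hw
    rw [Loewner.invFunOn_map_eq_of_eqOn hUc hU' heq hw, invFunOn_map_thrImageDriverC hW hW0 hA hcl hfin htβ hw]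
  -- the composite limit
  have hγt : γ t ∉ A := hγA t htβ.le
  have hlim : Tendsto (fun w ↦ starMap A (invFunOn (map W t) (domain W t)
      ((starRMap (thrSlidHull W A t) (isStarHull_thrSlidHull hW hA (hcl t htβ.le))).symm
        (w - thrImageDriver W A t) + W t)))
      (𝓝[upperHalfPlaneSet] (thrImageDriver W A t : ℂ)) (𝓝 (starMap A (γ t))) := by
    have h1 := tendsto_thr_preimagePoint hW hA hcl htβ.le
    have h2 := (hγ.tendsto_invFunOn_map hW t).comp h1
    exact ((continuousAt_starMap hA (hγ.im_nonneg t) hγt).tendsto).comp h2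
  have hlim' : Tendsto (invFunOn (map U' q) (domain U' q))
      (𝓝[upperHalfPlaneSet] (thrImageDriver W A t : ℂ)) (𝓝 (starMap A (γ t))) :=
    hlim.congr' (eventually_nhdsWithin_of_forall fun w hw ↦ (hev w hw).symm)
  haveI : (𝓝[upperHalfPlaneSet] ((thrImageDriver W A t : ℝ) : ℂ)).NeBot :=
    mem_closure_iff_nhdsWithin_neBot.1 (mem_closure_upperHalfPlaneSet_iff.2 (by rw [ofReal_im]))
  exact tendsto_nhds_unique htip' hlim'

end Loewner

end Literature.Probability.RandomPlanarGeometry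

end
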